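import Summits.AnomalousDissipation.AnomalousDissipation.Theorems.SolenoidalFractalHomogenisationLagrangianStepCellLawVOddGainDefectCubature
import HarnessLib

/-!
# The STRICT reversed-Minkowski inequality — §3: strict sectorial contraction of the quasi-static excess (K1L_D helper)

Third of three files splitting planner ad-ideate-p5 g8's `Cruxes/LagrangianRenormalisationStep/OddGainDefect.lean` (afb03e3ad1f1) at its section
boundaries for the 400-line rule; content byte-identical to §3 of that file: the strict twin of `oddSectorial_excQS_of_slot` (p644915) —
`sector_gram`, `abs_odd_le_sqrt_gram2`, `sector_sum_strict`, **`oddSectorial_excQS_strict`**, **`oddSectorial_excQS_strict_of_slot`**.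
No named facts, no sorry. Lander: prover ad-k3l-bookkeeping-p1 g4 (tenure D24-10 fallback).
-/

set_option linter.dupNamespace false
set_option linter.style.longLine false

noncomputable section

namespace Summit.AnomalousDissipation.AnomalousDissipation.Theorems.SolenoidalFractalHomogenisation.LagrangianStep.OddGain

open Matrix Finset
open Literature.Analysis.FluidPDE.KY (real_dot_eq)

/-! ## §3 STRICT sectorial contraction of the quasi-static excess (the strict twin of `oddSectorial_excQS_of_slot`, p644915) -/

section Strict

open Literature.Analysis Literature.Analysis.FunctionSpaces Literature.Analysis.FluidPDE
open Literature.Analysis.FluidPDE.LatticeShear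

/-- `Σ_i Σ_j p_i Q_ij q_j = pᵀ Q q`. [folklore] -/
theorem sum_sum_eq_form (Q : Matrix (Fin 3) (Fin 3) ℝ) (p q : Fin 3 → ℝ) :
    ∑ i, ∑ j, p i * Q i j * q j = p ⬝ᵥ Q *ᵥ q := by
  rw [form_fin_three]; simp only [Fin.sum_univ_three]; ring

/-- `|P_n x|² = |x|² − (n·x)²` for a unit normal: the transverse window of this file in the `projPerp` vocabulary of p643421. [folklore] -/
theorem perpSq_eq_projPerp (n x : Fin 3 → ℝ) (hn : ∑ a, n a ^ 2 = 1) :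
    ((projPerp n) *ᵥ x) ⬝ᵥ ((projPerp n) *ᵥ x) = perpSq n x := by
  simp only [Fin.sum_univ_three] at hn
  rw [perpSq, real_dot_eq, real_dot_eq, real_dot_eq]
  simp [Matrix.mulVec, dotProduct, projPerp, Fin.sum_univ_three]
  linear_combination ((n 0 * x 0 + n 1 * x 1 + n 2 * x 2) ^ 2) * hn

/-- The real `2×2` core: product-form sector for all `t` ⇒ Gram-form sector. -/
theorem sector_gram_aux {a b u v τ : ℝ} (hb : 0 ≤ b) (hm : ((u + v) / 2) ^ 2 ≤ a * b)
    (hst : ∀ t : ℝ, (u - v) ^ 2 ≤ τ ^ 2 * ((b * (t * t) + (u + v) * t + a) * b)) :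
    (u - v) ^ 2 ≤ τ ^ 2 * (a * b - ((u + v) / 2) ^ 2) := by
  rcases hb.eq_or_lt with hb0 | hbpos
  · subst hb0
    have h0 : (u - v) ^ 2 ≤ 0 := by have := hst 0; linarith [this]
    have hm0 : ((u + v) / 2) ^ 2 ≤ 0 := by simpa using hm
    nlinarith [h0, hm0, sq_nonneg ((u + v) / 2), mul_nonneg (sq_nonneg τ) (sq_nonneg ((u + v) / 2))]
  · have h := hst (-((u + v) / 2) / b)
    have hb0 : b ≠ 0 := hbpos.ne'
    have e : (b * ((-((u + v) / 2) / b) * (-((u + v) / 2) / b)) + (u + v) * (-((u + v) / 2) / b) + a) * b =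
        a * b - ((u + v) / 2) ^ 2 := by
      field_simp
      ring
    rwa [e] at h

/-- **PRODUCT-FORM SECTOR ⇒ GRAM-FORM SECTOR**: if the form of `Q` has nonnegative diagonal and satisfies the Kato-sector condition
`(xᵀQz − zᵀQx)² ≤ τ²(xᵀQx)(zᵀQz)` for ALL `x, z`, then on every pair `(p, q)`: `(pᵀQq − qᵀQp)² ≤ τ²·gram2 Q p q` (test the sector at
`(p + t q, q)` and optimise in `t`). [folklore] -/
theorem sector_gram (Q : Matrix (Fin 3) (Fin 3) ℝ) {τ : ℝ} (hpsd : ∀ x, 0 ≤ x ⬝ᵥ Q *ᵥ x)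
    (hsec : ∀ x z : Fin 3 → ℝ, (x ⬝ᵥ Q *ᵥ z - z ⬝ᵥ Q *ᵥ x) ^ 2 ≤ τ ^ 2 * ((x ⬝ᵥ Q *ᵥ x) * (z ⬝ᵥ Q *ᵥ z))) (p q : Fin 3 → ℝ) :
    (p ⬝ᵥ Q *ᵥ q - q ⬝ᵥ Q *ᵥ p) ^ 2 ≤ τ ^ 2 * gram2 Q p q := by
  obtain ⟨_, hb, hm⟩ := psd_data Q p q (fun t => hpsd _) (hpsd q)
  have hst : ∀ t : ℝ, (p ⬝ᵥ Q *ᵥ q - q ⬝ᵥ Q *ᵥ p) ^ 2 ≤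
      τ ^ 2 * (((q ⬝ᵥ Q *ᵥ q) * (t * t) + (p ⬝ᵥ Q *ᵥ q + q ⬝ᵥ Q *ᵥ p) * t + p ⬝ᵥ Q *ᵥ p) * (q ⬝ᵥ Q *ᵥ q)) := by
    intro t
    have h := hsec (p + t • q) q
    have e1 : (p + t • q) ⬝ᵥ Q *ᵥ q = p ⬝ᵥ Q *ᵥ q + t * (q ⬝ᵥ Q *ᵥ q) := by
      rw [add_dotProduct, smul_dotProduct, smul_eq_mul]
    have e2 : q ⬝ᵥ Q *ᵥ (p + t • q) = q ⬝ᵥ Q *ᵥ p + t * (q ⬝ᵥ Q *ᵥ q) := by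
      rw [Matrix.mulVec_add, Matrix.mulVec_smul, dotProduct_add, dotProduct_smul, smul_eq_mul]
    rw [e1, e2, form_add_smul] at h
    have e3 : p ⬝ᵥ Q *ᵥ q + t * (q ⬝ᵥ Q *ᵥ q) - (q ⬝ᵥ Q *ᵥ p + t * (q ⬝ᵥ Q *ᵥ q)) = p ⬝ᵥ Q *ᵥ q - q ⬝ᵥ Q *ᵥ p := by ring
    rwa [e3] at h
  unfold gram2
  exact sector_gram_aux hb hm hst

/-- … hence `|pᵀQq − qᵀQp| ≤ τ·√(gram2 Q p q)`. [folklore] -/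
theorem abs_odd_le_sqrt_gram2 (Q : Matrix (Fin 3) (Fin 3) ℝ) {τ : ℝ} (hτ : 0 ≤ τ) (hpsd : ∀ x, 0 ≤ x ⬝ᵥ Q *ᵥ x)
    (hsec : ∀ x z : Fin 3 → ℝ, (x ⬝ᵥ Q *ᵥ z - z ⬝ᵥ Q *ᵥ x) ^ 2 ≤ τ ^ 2 * ((x ⬝ᵥ Q *ᵥ x) * (z ⬝ᵥ Q *ᵥ z))) (p q : Fin 3 → ℝ) :
    |p ⬝ᵥ Q *ᵥ q - q ⬝ᵥ Q *ᵥ p| ≤ τ * Real.sqrt (gram2 Q p q) := by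
  have h := sector_gram Q hpsd hsec p q
  have hg : 0 ≤ gram2 Q p q := by
    obtain ⟨_, _, hm⟩ := psd_data Q p q (fun t => hpsd _) (hpsd q); unfold gram2; linarith
  calc |p ⬝ᵥ Q *ᵥ q - q ⬝ᵥ Q *ᵥ p| ≤ Real.sqrt (τ ^ 2 * gram2 Q p q) := Real.abs_le_sqrt h
    _ = τ * Real.sqrt (gram2 Q p q) := by rw [Real.sqrt_mul' _ hg, Real.sqrt_sq hτ]

/-- **STRICT SECTORIAL CONTRACTION, unit output direction** (the core): for a slot family `Q_s` whose forms are in the Kato sector `τ`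
(product form, all `x, z`) and in the common transverse window `y|P_s x|² ≤ xᵀQ_s x ≤ c·y|P_s x|²`, the `slotW κ`-weighted sum is in the
sector `(c√5/3)·τ` on `κ⊥` — versus `τ` in `oddSectorial_excQS_of_slot`. [folklore] -/
theorem sector_sum_strict (Q : Fin 26 → Matrix (Fin 3) (Fin 3) ℝ) {y c τ : ℝ} (hy : 0 ≤ y) (hc : 0 ≤ c) (hτ : 0 ≤ τ)
    (hsec : ∀ s, ∀ x z : Fin 3 → ℝ, (x ⬝ᵥ (Q s) *ᵥ z - z ⬝ᵥ (Q s) *ᵥ x) ^ 2 ≤ τ ^ 2 * ((x ⬝ᵥ (Q s) *ᵥ x) * (z ⬝ᵥ (Q s) *ᵥ z)))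
    (hwin : ∀ s x, y * perpSq (slotN s) x ≤ x ⬝ᵥ (Q s) *ᵥ x ∧ x ⬝ᵥ (Q s) *ᵥ x ≤ c * y * perpSq (slotN s) x)
    (κ p q : Fin 3 → ℝ) (hκ : κ ⬝ᵥ κ = 1) (hp : p ⬝ᵥ κ = 0) (hq : q ⬝ᵥ κ = 0) :
    (∑ s, slotW κ s * (p ⬝ᵥ (Q s) *ᵥ q) - ∑ s, slotW κ s * (q ⬝ᵥ (Q s) *ᵥ p)) ^ 2 ≤
      (c * Real.sqrt 5 / 3 * τ) ^ 2 * ((∑ s, slotW κ s * (p ⬝ᵥ (Q s) *ᵥ p)) * (∑ s, slotW κ s * (q ⬝ᵥ (Q s) *ᵥ q))) := by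
  have hpsd : ∀ s x, 0 ≤ x ⬝ᵥ (Q s) *ᵥ x := fun s x =>
    (mul_nonneg hy (perpSq_nonneg _ _ (slotN_unit s))).trans (hwin s x).1
  have hγ : 0 ≤ c * Real.sqrt 5 / 3 := by positivity
  -- (1) triangle inequality + per-slot Gram sector
  have h1 : |∑ s, slotW κ s * (p ⬝ᵥ (Q s) *ᵥ q) - ∑ s, slotW κ s * (q ⬝ᵥ (Q s) *ᵥ p)| ≤
      τ * ∑ s, slotW κ s * Real.sqrt (gram2 (Q s) p q) := by
    rw [← Finset.sum_sub_distrib, Finset.mul_sum]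
    refine (Finset.abs_sum_le_sum_abs _ _).trans (Finset.sum_le_sum fun s _ => ?_)
    rw [← mul_sub, abs_mul, abs_of_nonneg (slotW_nonneg κ s)]
    calc slotW κ s * |p ⬝ᵥ (Q s) *ᵥ q - q ⬝ᵥ (Q s) *ᵥ p| ≤ slotW κ s * (τ * Real.sqrt (gram2 (Q s) p q)) :=
          mul_le_mul_of_nonneg_left (abs_odd_le_sqrt_gram2 (Q s) hτ (hpsd s) (hsec s) p q) (slotW_nonneg κ s)
      _ = τ * (slotW κ s * Real.sqrt (gram2 (Q s) p q)) := by ring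
  -- (2) the strict reversed Minkowski inequality for the cubature word
  have h2 := strictMinkowski_cubatureWord κ p q hκ hp hq Q hy hc hwin
  -- (3) `gram2 G ≤ (pᵀGp)(qᵀGq)` and `pᵀGp = Σ_s w_s pᵀQ_s p`
  have hPP : 0 ≤ ∑ s, slotW κ s * (p ⬝ᵥ (Q s) *ᵥ p) := Finset.sum_nonneg fun s _ => mul_nonneg (slotW_nonneg κ s) (hpsd s p)
  have hQQ : 0 ≤ ∑ s, slotW κ s * (q ⬝ᵥ (Q s) *ᵥ q) := Finset.sum_nonneg fun s _ => mul_nonneg (slotW_nonneg κ s) (hpsd s q)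
  have hG : gram2 (∑ s, slotW κ s • Q s) p q ≤ (∑ s, slotW κ s * (p ⬝ᵥ (Q s) *ᵥ p)) * (∑ s, slotW κ s * (q ⬝ᵥ (Q s) *ᵥ q)) := by
    unfold gram2
    simp only [form_sum]
    linarith [sq_nonneg ((∑ s, slotW κ s * (p ⬝ᵥ (Q s) *ᵥ q) + ∑ s, slotW κ s * (q ⬝ᵥ (Q s) *ᵥ p)) / 2)]
  have h3 : |∑ s, slotW κ s * (p ⬝ᵥ (Q s) *ᵥ q) - ∑ s, slotW κ s * (q ⬝ᵥ (Q s) *ᵥ p)| ≤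
      (c * Real.sqrt 5 / 3 * τ) * Real.sqrt ((∑ s, slotW κ s * (p ⬝ᵥ (Q s) *ᵥ p)) * (∑ s, slotW κ s * (q ⬝ᵥ (Q s) *ᵥ q))) :=
    calc _ ≤ τ * ∑ s, slotW κ s * Real.sqrt (gram2 (Q s) p q) := h1
      _ ≤ τ * ((c * Real.sqrt 5 / 3) * Real.sqrt (gram2 (∑ s, slotW κ s • Q s) p q)) := mul_le_mul_of_nonneg_left h2 hτ
      _ ≤ τ * ((c * Real.sqrt 5 / 3) *
            Real.sqrt ((∑ s, slotW κ s * (p ⬝ᵥ (Q s) *ᵥ p)) * (∑ s, slotW κ s * (q ⬝ᵥ (Q s) *ᵥ q)))) :=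
          mul_le_mul_of_nonneg_left (mul_le_mul_of_nonneg_left (Real.sqrt_le_sqrt hG) hγ) hτ
      _ = _ := by ring
  -- (4) square
  have hR : 0 ≤ (c * Real.sqrt 5 / 3 * τ) *
      Real.sqrt ((∑ s, slotW κ s * (p ⬝ᵥ (Q s) *ᵥ p)) * (∑ s, slotW κ s * (q ⬝ᵥ (Q s) *ᵥ q))) :=
    mul_nonneg (mul_nonneg hγ hτ) (Real.sqrt_nonneg _)
  have h4 := sq_le_sq' (abs_le.1 h3).1 (abs_le.1 h3).2
  calc _ ≤ ((c * Real.sqrt 5 / 3 * τ) *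
        Real.sqrt ((∑ s, slotW κ s * (p ⬝ᵥ (Q s) *ᵥ p)) * (∑ s, slotW κ s * (q ⬝ᵥ (Q s) *ᵥ q)))) ^ 2 := h4
    _ = _ := by rw [mul_pow, Real.sq_sqrt (mul_nonneg hPP hQQ)]

/-- **STRICT SECTORIAL CONTRACTION OF THE QUASI-STATIC EXCESS** (p5's (L5) `SectorContraction`, modulo the per-slot response data):
if every slot response matrix `Q_s = slotQ W₀ M S s` of the cubature word has its form in the Kato sector `τ` and in the common transverse window
`y|P_s x|² ≤ xᵀQ_s x ≤ c·y|P_s x|²` (`y, c, τ ≥ 0`), then `excQS W₀ M S` is in the sector `(c·√5/3)·τ` — a STRICT contraction of the sector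
for every box ratio `c < 3/√5`.  (Compare `oddSectorial_excQS_of_slot`: sector `τ`, no window needed.) [folklore] -/
theorem oddSectorial_excQS_strict (Mlag : ℝ) (S : Torus.Visc4 (Fin 3)) {y c τ : ℝ} (hy : 0 ≤ y) (hc : 0 ≤ c) (hτ : 0 ≤ τ)
    (hsec : ∀ s, ∀ x z : Fin 3 → ℝ,
      (x ⬝ᵥ (slotQ cubatureWord Mlag S s) *ᵥ z - z ⬝ᵥ (slotQ cubatureWord Mlag S s) *ᵥ x) ^ 2 ≤
        τ ^ 2 * ((x ⬝ᵥ (slotQ cubatureWord Mlag S s) *ᵥ x) * (z ⬝ᵥ (slotQ cubatureWord Mlag S s) *ᵥ z)))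
    (hwin : ∀ s x, y * perpSq (slotN s) x ≤ x ⬝ᵥ (slotQ cubatureWord Mlag S s) *ᵥ x ∧
      x ⬝ᵥ (slotQ cubatureWord Mlag S s) *ᵥ x ≤ c * y * perpSq (slotN s) x) :
    OddSectorial (excQS cubatureWord Mlag S) (c * Real.sqrt 5 / 3 * τ) := by
  intro κ p q hp hq
  rw [Torus.symb_eq_bsymb, Torus.symb_eq_bsymb, bsymb_excQS, bsymb_excQS, bsymb_excQS, bsymb_excQS]
  simp only [sum_sum_eq_form]
  by_cases hκ0 : κ ⬝ᵥ κ = 0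
  · -- `κ = 0`: all weights vanish
    have hz : κ = 0 := dotProduct_self_eq_zero.1 hκ0
    subst hz
    simp
  · -- normalise `κ`
    have hr : 0 < κ ⬝ᵥ κ := lt_of_le_of_ne (by rw [real_dot_eq]; nlinarith [mul_self_nonneg (κ 0), mul_self_nonneg (κ 1), mul_self_nonneg (κ 2)]) (Ne.symm hκ0)
    set r := Real.sqrt (κ ⬝ᵥ κ) with hrdef
    have hr0 : 0 < r := Real.sqrt_pos.2 hr
    have hrr : r ^ 2 = κ ⬝ᵥ κ := Real.sq_sqrt hr.le
    let κ' : Fin 3 → ℝ := fun a => κ a / r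
    have hκ' : κ' ⬝ᵥ κ' = 1 := by
      have : κ' ⬝ᵥ κ' = (κ ⬝ᵥ κ) / r ^ 2 := by
        simp only [κ', real_dot_eq]; field_simp
      rw [this, hrr]; exact div_self hκ0
    have hp' : p ⬝ᵥ κ' = 0 := by
      have : p ⬝ᵥ κ' = (p ⬝ᵥ κ) / r := by simp only [κ', real_dot_eq]; field_simp
      rw [this, show p ⬝ᵥ κ = 0 from hp, zero_div]
    have hq' : q ⬝ᵥ κ' = 0 := by
      have : q ⬝ᵥ κ' = (q ⬝ᵥ κ) / r := by simp only [κ', real_dot_eq]; field_simp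
      rw [this, show q ⬝ᵥ κ = 0 from hq, zero_div]
    have key := sector_sum_strict (fun s => slotQ cubatureWord Mlag S s) hy hc hτ hsec hwin κ' p q hκ' hp' hq'
    -- the weights scale by `r²`
    have ew : ∀ s (F : ℝ), slotCoef cubatureWord s * (∑ a, (cubatureWord.phase s).e a * κ a) ^ 2 * F = r ^ 2 * (slotW κ' s * F) := by
      intro s F
      have e1 : ∑ a, (cubatureWord.phase s).e a * κ a = r * ∑ a, (cubatureWord.phase s).e a * κ' a := by
        rw [Finset.mul_sum]
        refine Finset.sum_congr rfl fun a _ => ?_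
        simp only [κ']; field_simp
      rw [e1, slotW]; ring
    simp only [ew, ← Finset.mul_sum]
    have hr2 : 0 ≤ r ^ 2 := sq_nonneg r
    calc (r ^ 2 * ∑ s, slotW κ' s * (p ⬝ᵥ (slotQ cubatureWord Mlag S s) *ᵥ q) -
          r ^ 2 * ∑ s, slotW κ' s * (q ⬝ᵥ (slotQ cubatureWord Mlag S s) *ᵥ p)) ^ 2 =
        (r ^ 2) ^ 2 * (∑ s, slotW κ' s * (p ⬝ᵥ (slotQ cubatureWord Mlag S s) *ᵥ q) -
          ∑ s, slotW κ' s * (q ⬝ᵥ (slotQ cubatureWord Mlag S s) *ᵥ p)) ^ 2 := by ring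
      _ ≤ (r ^ 2) ^ 2 * ((c * Real.sqrt 5 / 3 * τ) ^ 2 * ((∑ s, slotW κ' s * (p ⬝ᵥ (slotQ cubatureWord Mlag S s) *ᵥ p)) *
          (∑ s, slotW κ' s * (q ⬝ᵥ (slotQ cubatureWord Mlag S s) *ᵥ q)))) := mul_le_mul_of_nonneg_left key (sq_nonneg _)
      _ = _ := by ring

/-- **THE STRICT TWIN OF `oddSectorial_excQS_of_slot`** (same shape of hypothesis, one more clause): if for every slot `s` the quasi-static
response `f_{T_s} = qsResp ρ T_s` maps every block `B` in the Kato sector `τ` with spectrum in `[lo, hi]` (`0 ≤ lo ≤ 1 ≤ hi`) to a matrix whose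
form is in the sector `τ` AND whose TRANSVERSE form lies in the common window `y|P_s x|² ≤ (P_s x)ᵀ f_{T_s}(B) (P_s x) ≤ c·y|P_s x|²`, then for
every background `S` with `NearIso S lo hi` in the sector `τ` the quasi-static excess `excQS W₀ M S` of the cubature word is in the sector
`(c·√5/3)·τ`: the contraction factor `κ = c√5/3 < 1` of `SectorialOddChannelBoundOn` for `c < 3/√5`. [folklore] -/
theorem oddSectorial_excQS_strict_of_slot (Mlag : ℝ) {lo hi τ y c : ℝ} (hlo : 0 ≤ lo) (hlo1 : lo ≤ 1) (hhi1 : 1 ≤ hi)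
    (hy : 0 ≤ y) (hc : 0 ≤ c) (hτ : 0 ≤ τ)
    (hL1 : ∀ s : Fin 26, ∀ B : Matrix (Fin 3) (Fin 3) ℝ,
      (∀ x z : Fin 3 → ℝ, (x ⬝ᵥ B *ᵥ z - z ⬝ᵥ B *ᵥ x) ^ 2 ≤ τ ^ 2 * ((x ⬝ᵥ B *ᵥ x) * (z ⬝ᵥ B *ᵥ z))) →
      (∀ x : Fin 3 → ℝ, lo * (x ⬝ᵥ x) ≤ x ⬝ᵥ B *ᵥ x ∧ x ⬝ᵥ B *ᵥ x ≤ hi * (x ⬝ᵥ x)) →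
      (∀ x z : Fin 3 → ℝ,
        (x ⬝ᵥ (qsResp cubatureWord.ramp (4 * Real.pi ^ 2 * ‖Torus.latticeVec (cubatureWord.phase s).m‖ ^ 2 * Mlag *
            (cubatureWord.phase s).τ) B) *ᵥ z -
         z ⬝ᵥ (qsResp cubatureWord.ramp (4 * Real.pi ^ 2 * ‖Torus.latticeVec (cubatureWord.phase s).m‖ ^ 2 * Mlag *
            (cubatureWord.phase s).τ) B) *ᵥ x) ^ 2 ≤
        τ ^ 2 * ((x ⬝ᵥ (qsResp cubatureWord.ramp (4 * Real.pi ^ 2 * ‖Torus.latticeVec (cubatureWord.phase s).m‖ ^ 2 * Mlag *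
            (cubatureWord.phase s).τ) B) *ᵥ x) *
          (z ⬝ᵥ (qsResp cubatureWord.ramp (4 * Real.pi ^ 2 * ‖Torus.latticeVec (cubatureWord.phase s).m‖ ^ 2 * Mlag *
            (cubatureWord.phase s).τ) B) *ᵥ z))) ∧
      (∀ x : Fin 3 → ℝ,
        y * perpSq (slotN s) x ≤
          ((projPerp (slotN s)) *ᵥ x) ⬝ᵥ (qsResp cubatureWord.ramp (4 * Real.pi ^ 2 * ‖Torus.latticeVec (cubatureWord.phase s).m‖ ^ 2 *
            Mlag * (cubatureWord.phase s).τ) B) *ᵥ ((projPerp (slotN s)) *ᵥ x) ∧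
        ((projPerp (slotN s)) *ᵥ x) ⬝ᵥ (qsResp cubatureWord.ramp (4 * Real.pi ^ 2 * ‖Torus.latticeVec (cubatureWord.phase s).m‖ ^ 2 *
            Mlag * (cubatureWord.phase s).τ) B) *ᵥ ((projPerp (slotN s)) *ᵥ x) ≤ c * y * perpSq (slotN s) x))
    {S : Torus.Visc4 (Fin 3)} (hS : Torus.NearIso S lo hi) (hodd : OddSectorial S τ) :
    OddSectorial (excQS cubatureWord Mlag S) (c * Real.sqrt 5 / 3 * τ) := by
  have hform : ∀ s (x z : Fin 3 → ℝ), x ⬝ᵥ (slotQ cubatureWord Mlag S s) *ᵥ z =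
      ((projPerp (slotN s)) *ᵥ x) ⬝ᵥ (qsResp cubatureWord.ramp (4 * Real.pi ^ 2 * ‖Torus.latticeVec (cubatureWord.phase s).m‖ ^ 2 *
        Mlag * (cubatureWord.phase s).τ) (regBlock S (slotN s))) *ᵥ ((projPerp (slotN s)) *ᵥ z) := by
    intro s x z
    rw [← sum_sum_eq_form, slotQ_form_eq, slotN]
  refine oddSectorial_excQS_strict Mlag S hy hc hτ (fun s x z => ?_) (fun s x => ?_)
  · obtain ⟨hsec, _⟩ := hL1 s (regBlock S (slotN s)) (sectorForm_regBlock (sum_mhat_sq _) hS hlo hodd)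
      (window_regBlock (sum_mhat_sq _) hS hlo1 hhi1)
    rw [hform, hform, hform, hform]
    exact hsec _ _
  · obtain ⟨_, hw⟩ := hL1 s (regBlock S (slotN s)) (sectorForm_regBlock (sum_mhat_sq _) hS hlo hodd)
      (window_regBlock (sum_mhat_sq _) hS hlo1 hhi1)
    rw [hform]
    exact hw x

end Strict

end Summit.AnomalousDissipation.AnomalousDissipation.Theorems.SolenoidalFractalHomogenisation.LagrangianStep.OddGain

end
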